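import Mathlib
import Summits.NavierStokesRegularity.NavierStokesRegularity.Theorems.TypeIQuarterGateScarEnvelopeTypeIZoomDictionaryDefs
import Summits.NavierStokesRegularity.NavierStokesRegularity.Theorems.TypeIQuarterGateScarEnvelopeTypeISatelliteTowerDefs
import Summits.NavierStokesRegularity.NavierStokesRegularity.Theorems.TypeIQuarterGateScarEnvelopeTypeISatelliteTowerEnvelopeDefs
import Summits.NavierStokesRegularity.NavierStokesRegularity.Theorems.TypeIQuarterGateScarEnvelopeTypeIFatKill
import Summits.NavierStokesRegularity.NavierStokesRegularity.Theorems.TypeIQuarterGateScarEnvelopeTypeIBudgetViolators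
import Summits.NavierStokesRegularity.NavierStokesRegularity.Theorems.TypeIQuarterGateScarEnvelopeTypeIOfNoTwinScarObject
import Summits.NavierStokesRegularity.NavierStokesRegularity.Theorems.TypeIQuarterGateQuarterLawTypeIGlue
import Summits.NavierStokesRegularity.NavierStokesRegularity.Theorems.TypeIQuarterGateEnvelopeQuarterLaw
import Summits.NavierStokesRegularity.NavierStokesRegularity.Theorems.TypeIQuarterGateScarEnvelopeTypeINearOneRateDss
import Literature.Analysis.FluidPDE.AncientAxisymmetricTypeILiouville

/-!
# Satellite tower for crux `ScarEnvelopeTypeI` (stmt-NavierStokesRegularity-23843) — DEFINITIONS (Parts M–N: root meter, rate ladder)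

DEFINITIONS ONLY (Part M «THE ROOT METER» and Part N «THE RATE LADDER» of the ROUND-33/34 plates): `RootObj`, `TameRoot`,
`RootDescends`, `InfiniteRootDescent`, `EnvelopedRootTwinScar`; `RateAt` (local sup-norm Type-I rate at a final-time point),
`tightRate`, the print-fact SHAPE `SmallRateRegularity M ε` (Wang–Zhang 2014 Thm 3.2 read in sup-norm; a HYPOTHESIS, not in the
tree), `singRates`/`minSingRate`, `EquiRated`/`EquiRatedLeaf`, `ExactMin`, and the hypothesis shape `MinSingRateAttained` (OPEN).
Nothing is asserted here.

PROVENANCE: declaration texts VERBATIM from the HOME plates of the instrument seat nsreg-p3 (g24/g25, cell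
`pub/ns-regularity-ideate`): `round-31/Tangent31prep.lean` v5 (sha16 `e5b8668e3a090216`; = ROUND-30 plate v10 + Part K) and,
for Part L, `round-32/Tangent32prep.lean` v6 (sha16 `6123f27718636121`); for Parts M/N, `round-34/Tangent34prep.lean`
v8 (sha16 `84f56c3bc8f4da24`; = v7 `922795f19cd5db01` + Part N);
the author cannot write under `Theorems/` (`perm.theorems-prover-only`); landed by the
LEAD-lineage prover ns-sz-p1 g5 on director-ns DIRECTOR-NS #218 (2), split into ≤ 400-line modules (the
plate's `def`s gathered in `TypeIQuarterGateScarEnvelopeTypeIZoomDictionaryDefs`), namespace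
`Summit.NavierStokesRegularity.NavierStokesRegularity.Cruxes.ScarEnvelopeTypeI.ZoomDictionary` (the plate's `NsregP3.R30P`), `E3` spelled out, one-line docstrings
added where the plate had none.  `--supports stmt-NavierStokesRegularity-23843 --as helper`.
REVIEW p632872 (revise) applied: only the dependency cone of Parts D–K is landed (206 of 240 declarations) —
the general-`ν` abstract dictionary in a second cylinder currency (`bCyl`/`bCylOpens`/`RegAt`/`TangentC`, the
fact-shaped hypotheses F1–F3 and `dictionary`/`…_of_vertexBounds`/`…_of_classical` of Parts B2/B4/C) is NOT
landed; the three remaining uses of the plate's `bCyl y r` are the literal `Ioo (-(r^2)) 0 ×ˢ ball y r` with the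
conversion `Ioo_prod_ball_eq_parabolicCylinder` to the tree's `parabolicCylinder`; ONE final-time regularity
notion `RegPt`; `zoom_eq_smul_stPull`/`zoomP_eq_smul_stPull` sit next to `zoom`/`zoomP` in the Defs module.

HONEST FRAMING: dictionary / census TOOLING for the crux `TypeIQuarterGate.ScarEnvelopeTypeI` (item 23843):
equivalences and normal forms, kernel-checked; NO open statement is proved — 23843, its parent
`QuarterLawTypeI` (23726), the route and Navier–Stokes regularity are OPEN; hard core evaded: none.
-/

noncomputable section

-- the summit-side namespace repeats a component by design (single-conjunct summit, D-0017)
set_option linter.dupNamespace false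

open MeasureTheory Set Metric Filter Topology
open scoped ENNReal

namespace Summit.NavierStokesRegularity.NavierStokesRegularity.Cruxes.ScarEnvelopeTypeI.ZoomDictionary

variable {u : ℝ → (EuclideanSpace ℝ (Fin 3)) → (EuclideanSpace ℝ (Fin 3))} {a : (EuclideanSpace ℝ (Fin 3))} {ν T : ℝ}

section Tower

open Literature.Analysis.FluidPDE
variable {U : ℝ → (EuclideanSpace ℝ (Fin 3)) → (EuclideanSpace ℝ (Fin 3))} {P : ℝ → (EuclideanSpace ℝ (Fin 3)) → ℝ} {y' : (EuclideanSpace ℝ (Fin 3))} {ν : ℝ}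
open Summit.NavierStokesRegularity.NavierStokesRegularity.Cruxes.ScarEnvelopeTypeI.ScarZoom
  (CruxHypotheses ScarViolators TwinScarObject singularAt_of_isBackwardSingularPoint
    exists_localEnergy_of_typeIBound) in

/-- ROOT OBJECTS: A–B objects (rate `M`) singular at the final-time origin (the node's point `n.y`
records the sphere satellite handed down by `RootDescends`; it is not constrained here). -/
def RootObj (M : ℝ) (n : TNode) : Prop := ABTower M n.U n.P n.H ∧ ¬ RegPt n.U 0

/-- TAME ROOT: the slice budget of `n.U` holds at the origin (⟺ `n.U` is KNSS-enveloped at its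
root, ROUND-32 ★). -/
def TameRoot (n : TNode) : Prop := BudgetAt 1 0 n.U 0

/-- `n` ROOT-DESCENDS to `n'`: `n'.U` is (a.e. on every `Q_R(0)`, `R < 1`) a tangent flow of `n.U`
AT THE ROOT `0`, and `n'.y` is a satellite of `n'.U` ON THE SPHERE `‖y‖ = 1/4`. -/
def RootDescends (n n' : TNode) : Prop :=
  ∃ (L : ℕ → ℝ) (Ū : ℝ → (EuclideanSpace ℝ (Fin 3)) → (EuclideanSpace ℝ (Fin 3))), TangentU n.U n.P 0 0 L Ū ∧
    (∀ R ∈ Ioo (0 : ℝ) 1,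
      ∀ᵐ z ∂(volume.restrict (parabolicCylinder R (0 : ℝ × (EuclideanSpace ℝ (Fin 3))))), Ū z.1 z.2 = n'.U z.1 z.2) ∧
    ‖n'.y‖ = 1 / 4 ∧ n'.y ∈ satellites n'.U

/-- An **INFINITE ROOT DESCENT** (E2ᵣ) of rate `M`: an infinite chain of root objects, every level
NON-tame at its root, each root-descending to the next (so every level `k ≥ 1` carries a satellite
on the sphere `‖y‖ = 1/4`). -/
def InfiniteRootDescent (M : ℝ) : Prop :=
  ∃ c : ℕ → TNode, ∀ k, RootObj M (c k) ∧ ¬ TameRoot (c k) ∧ RootDescends (c k) (c (k + 1))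

/-- An **ENVELOPED-ROOT TWIN SCAR** of rate `M`: an A–B object SINGULAR at the final-time origin,
obeying the KNSS space–time envelope on a backward neighbourhood of the origin (TAME root), and
carrying a satellite (which lies outside the envelope ball, `regPt_of_localEnvelope`).  Its tangent
flows at the root are ENVELOPED LEAVES (`envelopedLeaf_of_tameRoot`). -/
def EnvelopedRootTwinScar (M : ℝ) : Prop :=
  ∃ (U : ℝ → (EuclideanSpace ℝ (Fin 3)) → (EuclideanSpace ℝ (Fin 3))) (P : ℝ → (EuclideanSpace ℝ (Fin 3)) → ℝ) (H : ℝ → (EuclideanSpace ℝ (Fin 3)) → (EuclideanSpace ℝ (Fin 3)) →L[ℝ] (EuclideanSpace ℝ (Fin 3))),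
    ABTower M U P H ∧ ¬ RegPt U 0 ∧
      (∃ A δ : ℝ, 0 < δ ∧ ∀ t ∈ Ioo (-(δ ^ 2)) 0, ∀ x ∈ ball (0 : (EuclideanSpace ℝ (Fin 3))) δ,
        ‖U t x‖ ≤ A / (‖x - 0‖ + Real.sqrt (-t))) ∧
      (satellites U).Nonempty

/-- The **local sup-norm Type-I rate** `m` at the final-time point `y'`: `√(−t)‖U(t,x)‖ ≤ m` on some
backward cylinder `(−δ², 0) × B(y', δ)`. -/
def RateAt (m : ℝ) (U : ℝ → (EuclideanSpace ℝ (Fin 3)) → (EuclideanSpace ℝ (Fin 3))) (y' : (EuclideanSpace ℝ (Fin 3))) : Prop :=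
  ∃ δ : ℝ, 0 < δ ∧ ∀ t ∈ Ioo (-(δ ^ 2)) 0, ∀ x ∈ ball y' δ, Real.sqrt (-t) * ‖U t x‖ ≤ m

/-- The **tight local rate** at `y'`: the infimum of the local sup-norm Type-I constants at `y'`. -/
noncomputable def tightRate (U : ℝ → (EuclideanSpace ℝ (Fin 3)) → (EuclideanSpace ℝ (Fin 3))) (y' : (EuclideanSpace ℝ (Fin 3))) : ℝ := sInf {m : ℝ | RateAt m U y'}

/-- PRINT-FACT SHAPE, used ONLY as a hypothesis (NOT in the tree): **small local sup-norm Type-I rate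
⇒ regular** in the engine class — Wang–Zhang, J. Anal. Math. 123 (2014) = arXiv:1201.1100, Thm 3.2
with `p = ∞`, `1 < q < 2` (the rate `M` bounds the scale-invariant `G(u,∞,q;r) ≤ C_q M` at every
`r`; smallness `G(u,∞,q;r*) ≤ ε₃(q,M)` is required at ONE radius `r* < min{1/2, (C(u,1)+D(π,1))⁻²}`
— the radius is supplied by `RateAt` after rescaling, the finiteness of `C + D` by the `cknC`/`cknD`
clause of `TowerObj`), read in sup-norm as in Remark 3.4 («`u` is regular if `|u_h| ≤ ε₃/√(T − t)`,
`|u_3| ≤ M/√(T − t)`»).  `ε` depends on `M` only; its value is NOT explicit in print (compactness). -/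
def SmallRateRegularity (M ε : ℝ) : Prop :=
  ∀ (U : ℝ → (EuclideanSpace ℝ (Fin 3)) → (EuclideanSpace ℝ (Fin 3))) (P : ℝ → (EuclideanSpace ℝ (Fin 3)) → ℝ), TowerObj M U P → ∀ y' : (EuclideanSpace ℝ (Fin 3)), RateAt ε U y' → RegPt U y'

/-- The set of tight rates realised at SINGULAR final-time points of objects of the class `ABTower M`. -/
def singRates (M : ℝ) : Set ℝ :=
  {r | ∃ (U : ℝ → (EuclideanSpace ℝ (Fin 3)) → (EuclideanSpace ℝ (Fin 3))) (P : ℝ → (EuclideanSpace ℝ (Fin 3)) → ℝ) (H : ℝ → (EuclideanSpace ℝ (Fin 3)) → (EuclideanSpace ℝ (Fin 3)) →L[ℝ] (EuclideanSpace ℝ (Fin 3))) (y : (EuclideanSpace ℝ (Fin 3))),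
    ABTower M U P H ∧ ¬ RegPt U y ∧ r = tightRate U y}

/-- The **class-wide minimal singular rate** `m_*(M)`. -/
noncomputable def minSingRate (M : ℝ) : ℝ := sInf (singRates M)

/-- An **EQUI-RATED** object of the class at level `(m, η)`: singular at the root, local rate
`≤ m + η` at every point of the open unit ball, tight rate `≥ m` at every singular point. -/
def EquiRated (M m η : ℝ) (n : TNode) : Prop :=
  ABTower M n.U n.P n.H ∧ ¬ RegPt n.U 0 ∧ (∀ y : (EuclideanSpace ℝ (Fin 3)), ‖y‖ < 1 → RateAt (m + η) n.U y) ∧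
    ∀ y : (EuclideanSpace ℝ (Fin 3)), ¬ RegPt n.U y → m ≤ tightRate n.U y

/-- An **EQUI-RATED ENVELOPED LEAF**: an enveloped leaf of rate `M` (KNSS envelope `A/(‖x‖+√(−t))`,
singular exactly at the origin among final-time points) that is moreover equi-rated at level `(m, η)`. -/
def EquiRatedLeaf (M m η : ℝ) : Prop :=
  ∃ n : TNode, ∃ A : ℝ, EquiRated M m η n ∧ HasTypeIDecay A n.U

/-- An **exact minimiser**: an object of the class with a scar at the root of tight rate equal to the
class-wide minimal singular rate.  OPEN whether it exists (S∞). -/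
def ExactMin (M : ℝ) (n : TNode) : Prop :=
  ABTower M n.U n.P n.H ∧ ¬ RegPt n.U 0 ∧ tightRate n.U 0 = minSingRate M

/-- Exact minimisers exist as soon as the infimum is ATTAINED — e.g. trivially when the set of
singular rates is finite; in general this is (S∞), OPEN here. Recorded as the hypothesis shape. -/
def MinSingRateAttained (M : ℝ) : Prop := minSingRate M ∈ singRates M


end Tower

end Summit.NavierStokesRegularity.NavierStokesRegularity.Cruxes.ScarEnvelopeTypeI.ZoomDictionary

end
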